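import Summits.BirchSwinnertonDyer.BirchSwinnertonDyer.Theorems.ByReductionTypeAtTwoRankOneNaiveSigmaLogValues
import Summits.BirchSwinnertonDyer.BirchSwinnertonDyer.Theorems.ByReductionTypeAtTwoRankOneNaiveSigmaEvalLog
import Literature.NumberTheory.EllipticCurves.CanonicalPAdicHeightNumeratorProofs
import HarnessLib

/-!
# Route `ByReductionTypeAtTwo`, crux `RankOneAtTwoBigImageOddLocal` (item stmt-BirchSwinnertonDyer-23715), line AN62, σ₀-LEMMA BLOCK
# (cell `bsd-f1-sign2`, planner seat `-an` g49; `--supports 23715`, helper; sequel of `…NaiveSigmaLogValues` / `…NaiveSigmaEvalLog`):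
# **the naive `2`-adic σ-height to first order** — `‖(log₂ den x − log₂ Σ₀(−x/y)) − (log₂ den x − 2log₂(−x/y))‖ ≤ ‖x‖₂⁻¹` at level
# `≥ 2`, `(den x)³ = (den y)²`, and the admissible form `‖h + 2log₂(num x/num y)‖ ≤ 2⁻⁸` at level `≥ 4`

HONEST FRAMING (D-0036/D-0054): THEOREMS ONLY (no definition, no named fact, no `sorry`, no instance).  For a `ℤ`-integral
Weierstrass model `V/ℚ` with `a₁ = 0`, the even constant-`0` sigma-squared series `Σ₀` of `V ⊗ ℚ₂` (`Σ₀ = t² + O(t⁴)`, `[t³]Σ₀ = 0`,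
`SatisfiesSigmaSqODE Σ₀ 0`) and a rational point `P = (x, y)`: the quantity `h(P) := log₂ den x − log₂ Σ₀(−x/y)` (the workfile's
`etaHeightAtTwo`, written out — no definition is introduced here) is a NAIVE local expression, NOT the canonical height and NOT a
statement about `BSDp`; item 23715 stays OPEN; BSD is proved for no curve.  Gate-backed forms of the workfile theorems 53E / 53F / 50H
of `Cruxes/RankOneAtTwoBigImageOddLocal/WildPairHeightAN62.lean` §9 (-an g49).

* §1 `norm_natCast_den_eq` (`‖den q‖_ℓ = (max 1 ‖q‖_ℓ)⁻¹`), `norm_cast_y_le_one_of_norm_cast_x_le_one` (`x ∈ ℤ_(ℓ) ⟹ y ∈ ℤ_(ℓ)` on an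
  integral model), **`den_pow_three_eq_den_sq`** (53F: `(den x)³ = (den y)²`, every prime, from the tree's
  `norm_div_sq_eq_inv_norm_of_one_lt_norm`), `padicLog_div_two`, `exists_sigmaLog_two` (a log `L` of `Σ₀/t²`: `L(0) = 0`, `S·L′ = S′`),
  `baseChange_padic_two_a`.
* §2 **`norm_sigmaHeightTwo_sub_firstOrder_le`** (53E) — `‖h(P) − (log₂ den x − 2log₂(−x/y))‖ ≤ ‖x‖₂⁻¹` for `‖x‖₂ ≥ 16`: the `2`-adic,
  naive-σ analogue of the tree's `norm_canonicalPAdicHeight_sub_firstOrder_le` (odd `p`, canonical σ).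
* §3 **`norm_sigmaHeightTwo_add_two_mul_padicLog_le`** (50H) — `‖h(P) + 2log₂(num x/num y)‖ ≤ 2⁻⁸` for `‖x‖₂ ≥ 256`.

PLACEMENT (REF2 v75 B2 / add3): the `2⁻⁸`-law for the naive σ-height at a supersingular `2` was not found in print; nearest print Bernardi
1981 §1 (naive heights, every `p`), MST06 §2.7/§4, Wuthrich 2004 Prop. 2.  References: [cite: Bernardi1981, §1]
[cite: MazurSteinTate2006, §2.7, §4] [cite: SilvermanAEC2009, VII.2.2] [cite: Wuthrich2004, Prop. 2].
-/

set_option autoImplicit false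

noncomputable section

open scoped Classical

open PowerSeries WeierstrassCurve Literature.NumberTheory.EllipticCurves

namespace Summit.BirchSwinnertonDyer.BirchSwinnertonDyer.Theorems

namespace NaiveSigmaLogAtTwo

/-! ### §1 Denominators of rational points; a log of `Σ₀/t²`; base change -/

/-- `‖den q‖_ℓ = (max 1 ‖q‖_ℓ)⁻¹` (lowest terms). -/
theorem norm_natCast_den_eq {ℓ : ℕ} [Fact ℓ.Prime] (q : ℚ) : ‖(q.den : ℚ_[ℓ])‖ = (max 1 ‖(q : ℚ_[ℓ])‖)⁻¹ := by
  have hℓ : Nat.Prime ℓ := Fact.out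
  have hden0 : (q.den : ℚ_[ℓ]) ≠ 0 := by exact_mod_cast q.den_nz
  have hq : (q : ℚ_[ℓ]) = (q.num : ℚ_[ℓ]) / (q.den : ℚ_[ℓ]) := by exact_mod_cast (Rat.num_div_den q).symm
  have hnum1 : ‖(q.num : ℚ_[ℓ])‖ ≤ 1 := Padic.norm_int_le_one _
  have hden1 : ‖(q.den : ℚ_[ℓ])‖ ≤ 1 := by simpa using Padic.norm_int_le_one (p := ℓ) (q.den : ℤ)
  rcases hden1.lt_or_eq with hlt | heq
  · have hpd : ℓ ∣ q.den := Padic.norm_natCast_lt_one_iff.mp hlt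
    have hnum : ‖(q.num : ℚ_[ℓ])‖ = 1 := by
      refine le_antisymm hnum1 (not_lt.mp fun hlt' => ?_)
      have hpn : (ℓ : ℤ) ∣ q.num := Padic.norm_intCast_lt_one_iff.mp hlt'
      have hg : ℓ ∣ Nat.gcd q.num.natAbs q.den := Nat.dvd_gcd (Int.natCast_dvd.mp hpn) hpd
      rw [q.reduced] at hg
      exact absurd (Nat.le_of_dvd one_pos hg) (by have := hℓ.one_lt; omega)
    have hpos : 0 < ‖(q.den : ℚ_[ℓ])‖ := norm_pos_iff.mpr hden0
    rw [hq, norm_div, hnum, max_eq_right (by rw [le_div_iff₀ hpos]; linarith), inv_div, div_one]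
  · rw [hq, norm_div, heq, div_one, max_eq_left hnum1, inv_one]

/-- On a `ℤ`-integral model, `x ∈ ℤ_(ℓ)` forces `y ∈ ℤ_(ℓ)` (`y` is integral over `ℤ_(ℓ)[x]`). -/
theorem norm_cast_y_le_one_of_norm_cast_x_le_one (V : WeierstrassCurve ℚ) [V.IsIntegral ℤ] {ℓ : ℕ} [Fact ℓ.Prime] {x y : ℚ}
    (h : V.toAffine.Nonsingular x y) (hx : ‖(x : ℚ_[ℓ])‖ ≤ 1) : ‖(y : ℚ_[ℓ])‖ ≤ 1 := by
  have ha1 := (mem_localIntegers_iff ℓ _).mp (V.a₁_mem_localIntegers ℓ)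
  have ha2 := (mem_localIntegers_iff ℓ _).mp (V.a₂_mem_localIntegers ℓ)
  have ha3 := (mem_localIntegers_iff ℓ _).mp (V.a₃_mem_localIntegers ℓ)
  have ha4 := (mem_localIntegers_iff ℓ _).mp (V.a₄_mem_localIntegers ℓ)
  have ha6 := (mem_localIntegers_iff ℓ _).mp (V.a₆_mem_localIntegers ℓ)
  have heq : (y : ℚ_[ℓ]) * ((y : ℚ_[ℓ]) + (V.a₁ : ℚ_[ℓ]) * x + V.a₃) =
      (x : ℚ_[ℓ]) ^ 3 + (V.a₂ : ℚ_[ℓ]) * x ^ 2 + (V.a₄ : ℚ_[ℓ]) * x + V.a₆ := by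
    have e := (WeierstrassCurve.Affine.equation_iff x y).mp h.1
    have e' := congrArg (fun r : ℚ => (r : ℚ_[ℓ])) e
    push_cast at e'
    linear_combination e'
  by_contra hy
  rw [not_le] at hy
  have hsmall : ‖(V.a₁ : ℚ_[ℓ]) * x + V.a₃‖ < ‖(y : ℚ_[ℓ])‖ := by
    refine lt_of_le_of_lt ((IsUltrametricDist.norm_add_le_max _ _).trans (max_le ?_ ha3)) hy
    rw [norm_mul]; exact mul_le_one₀ ha1 (norm_nonneg _) hx
  have hfac : ‖(y : ℚ_[ℓ]) + ((V.a₁ : ℚ_[ℓ]) * x + V.a₃)‖ = ‖(y : ℚ_[ℓ])‖ := by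
    rw [IsUltrametricDist.norm_add_eq_max_of_norm_ne_norm (ne_of_gt hsmall), max_eq_left hsmall.le]
  have hl : ‖(y : ℚ_[ℓ]) * ((y : ℚ_[ℓ]) + (V.a₁ : ℚ_[ℓ]) * x + V.a₃)‖ = ‖(y : ℚ_[ℓ])‖ * ‖(y : ℚ_[ℓ])‖ := by
    rw [norm_mul, ← hfac, add_assoc]
  have hr : ‖(x : ℚ_[ℓ]) ^ 3 + (V.a₂ : ℚ_[ℓ]) * x ^ 2 + (V.a₄ : ℚ_[ℓ]) * x + V.a₆‖ ≤ 1 := by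
    refine (IsUltrametricDist.norm_add_le_max _ _).trans (max_le ?_ ha6)
    refine (IsUltrametricDist.norm_add_le_max _ _).trans (max_le ?_ ?_)
    · refine (IsUltrametricDist.norm_add_le_max _ _).trans (max_le ?_ ?_)
      · rw [norm_pow]; exact pow_le_one₀ (norm_nonneg _) hx
      · rw [norm_mul, norm_pow]; exact mul_le_one₀ ha2 (by positivity) (pow_le_one₀ (norm_nonneg _) hx)
    · rw [norm_mul]; exact mul_le_one₀ ha4 (norm_nonneg _) hx
  rw [heq] at hl
  have : (1 : ℝ) < ‖(y : ℚ_[ℓ])‖ * ‖(y : ℚ_[ℓ])‖ := by nlinarith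
  linarith

/-- **53F — `den x = d²`, `den y = d³`** (kernel): for a `ℤ`-integral Weierstrass equation and an affine point `(x, y) ∈ V(ℚ)`,
`(den x)³ = (den y)²` (prime by prime: `‖x‖_ℓ ≤ 1 ⇒ ‖y‖_ℓ ≤ 1`, and `‖x‖_ℓ > 1 ⇒ ‖y‖_ℓ² = ‖x‖_ℓ³` from the tree's
`norm_div_sq_eq_inv_norm_of_one_lt_norm`). [cite: SilvermanAEC2009, VII.2.2, VIII.7 (x = a/d², y = b/d³)] -/
theorem den_pow_three_eq_den_sq (V : WeierstrassCurve ℚ) [V.IsIntegral ℤ] {x y : ℚ} (h : V.toAffine.Nonsingular x y) :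
    x.den ^ 3 = y.den ^ 2 := by
  refine (Nat.eq_iff_prime_padicValNat_eq _ _ (pow_ne_zero 3 x.den_nz) (pow_ne_zero 2 y.den_nz)).mpr fun ℓ hℓ => ?_
  haveI : Fact ℓ.Prime := ⟨hℓ⟩
  have key : ‖((x.den ^ 3 : ℕ) : ℚ_[ℓ])‖ = ‖((y.den ^ 2 : ℕ) : ℚ_[ℓ])‖ := by
    push_cast
    rw [norm_pow, norm_pow, norm_natCast_den_eq x, norm_natCast_den_eq y]
    rcases le_or_gt ‖(x : ℚ_[ℓ])‖ 1 with hx1 | hx1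
    · rw [max_eq_left hx1, max_eq_left (norm_cast_y_le_one_of_norm_cast_x_le_one V h hx1), inv_one, one_pow, one_pow]
    · have hsq := WeierstrassCurve.norm_div_sq_eq_inv_norm_of_one_lt_norm h hx1
      have hX0 : (x : ℚ_[ℓ]) ≠ 0 := fun e => by rw [e, norm_zero] at hx1; linarith
      have hY0 : (y : ℚ_[ℓ]) ≠ 0 := by
        intro e
        rw [e, div_zero, norm_zero, zero_pow two_ne_zero] at hsq
        exact (inv_ne_zero (norm_ne_zero_iff.mpr hX0)) hsq.symm
      have e1 : ‖(x : ℚ_[ℓ]) / y‖ ^ 2 * ‖(y : ℚ_[ℓ])‖ ^ 2 = ‖(x : ℚ_[ℓ])‖ ^ 2 := by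
        rw [← mul_pow, ← norm_mul, div_mul_cancel₀ _ hY0]
      rw [hsq, inv_mul_eq_div, div_eq_iff (norm_ne_zero_iff.mpr hX0)] at e1
      have hy3 : ‖(y : ℚ_[ℓ])‖ ^ 2 = ‖(x : ℚ_[ℓ])‖ ^ 3 := by rw [e1]; ring
      have hy1 : 1 < ‖(y : ℚ_[ℓ])‖ := by
        by_contra hy
        rw [not_lt] at hy
        have h1 : ‖(y : ℚ_[ℓ])‖ ^ 2 ≤ 1 := pow_le_one₀ (norm_nonneg _) hy
        have h2 : (1 : ℝ) < ‖(x : ℚ_[ℓ])‖ ^ 3 := one_lt_pow₀ hx1 three_ne_zero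
        linarith
      rw [max_eq_right hx1.le, max_eq_right hy1.le, inv_pow, inv_pow, hy3]
  have hxne : ((x.den ^ 3 : ℕ) : ℚ_[ℓ]) ≠ 0 := by exact_mod_cast pow_ne_zero 3 x.den_nz
  have hyne : ((y.den ^ 2 : ℕ) : ℚ_[ℓ]) ≠ 0 := by exact_mod_cast pow_ne_zero 2 y.den_nz
  rw [Padic.norm_eq_zpow_neg_valuation hxne, Padic.norm_eq_zpow_neg_valuation hyne, Padic.valuation_natCast,
    Padic.valuation_natCast] at key
  have hℓ1 : (1 : ℝ) < ℓ := by exact_mod_cast hℓ.one_lt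
  have := zpow_right_injective₀ (by positivity) hℓ1.ne' key
  simp only [neg_inj, Nat.cast_inj] at this
  exact this

/-- `log₂(a/b) = log₂ a − log₂ b` (`a, b ≠ 0`). -/
theorem padicLog_div_two {a b : ℚ_[2]} (ha : a ≠ 0) (hb : b ≠ 0) : padicLog 2 (a / b) = padicLog 2 a - padicLog 2 b := by
  have e : padicLog 2 a = padicLog 2 (a / b) + padicLog 2 b := by
    rw [← padicLog_mul_holds 2 (div_ne_zero ha hb) hb, div_mul_cancel₀ _ hb]
  rw [e]; ring

/-- **A log of `S = Σ₀/t²`**: some `L ∈ ℚ₂⟦t⟧` has `L(0) = 0` and `S·L′ = S′` (`L′ := S′·S⁻¹`, `S(0) = 1`). [cite: MazurSteinTate2006, §2.7] -/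
theorem exists_sigmaLog_two (Sq : ℚ_[2]⟦X⟧) (h2 : coeff 2 Sq = 1) :
    ∃ L : ℚ_[2]⟦X⟧, constantCoeff L = 0 ∧
      sigmaShift (sigmaShift Sq) * d⁄dX ℚ_[2] L = d⁄dX ℚ_[2] (sigmaShift (sigmaShift Sq)) := by
  set S : ℚ_[2]⟦X⟧ := sigmaShift (sigmaShift Sq) with hS
  set L : ℚ_[2]⟦X⟧ :=
    PowerSeries.mk fun n => if n = 0 then 0 else (coeff (n - 1) (d⁄dX ℚ_[2] S * S.invOfUnit 1)) / (n : ℚ_[2]) with hLdef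
  refine ⟨L, ?_, ?_⟩
  · rw [← coeff_zero_eq_constantCoeff_apply, hLdef, coeff_mk, if_pos rfl]
  · have hS0 : constantCoeff S = 1 := by rw [hS, constantCoeff_sigmaShift, coeff_sigmaShift, h2]
    have hSi : S * S.invOfUnit 1 = 1 := mul_invOfUnit S 1 (by rw [hS0, Units.val_one])
    have hd : d⁄dX ℚ_[2] L = d⁄dX ℚ_[2] S * S.invOfUnit 1 := by
      ext n
      have hn : ((n : ℚ_[2]) + 1) ≠ 0 := by exact_mod_cast Nat.succ_ne_zero n
      rw [coeff_derivative, hLdef, coeff_mk, if_neg (Nat.succ_ne_zero n), Nat.succ_sub_one]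
      push_cast
      rw [div_mul_cancel₀ _ hn]
    rw [hd, mul_comm S, mul_assoc, mul_comm (S.invOfUnit 1) S, hSi, mul_one]

/-- The `a_i` of `V ⊗ ℚ₂` are the casts of the `a_i` of `V`. -/
theorem baseChange_padic_two_a (V : WeierstrassCurve ℚ) :
    (V.baseChange ℚ_[2]).a₁ = (V.a₁ : ℚ_[2]) ∧ (V.baseChange ℚ_[2]).a₂ = (V.a₂ : ℚ_[2]) ∧
      (V.baseChange ℚ_[2]).a₃ = (V.a₃ : ℚ_[2]) ∧ (V.baseChange ℚ_[2]).a₄ = (V.a₄ : ℚ_[2]) ∧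
      (V.baseChange ℚ_[2]).a₆ = (V.a₆ : ℚ_[2]) := by
  simp [WeierstrassCurve.baseChange]

/-! ### §2 53E — the naive σ-height to first order at level `≥ 2` -/

/-- **53E — THE NAIVE `2`-ADIC σ-HEIGHT TO FIRST ORDER** (kernel): for a `ℤ`-integral model with `a₁ = 0`, its even constant-`0`
sigma-squared series `Σ₀` at `2`, and a point with `‖x‖₂ ≥ 16` (level `≥ 2`),
`‖(log₂ den x − log₂ Σ₀(−x/y)) − (log₂ den x − 2·log₂(−x/y))‖ ≤ ‖x‖₂⁻¹` — the 2-adic analogue of the tree's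
`norm_canonicalPAdicHeight_sub_firstOrder_le`. [cite: MazurSteinTate2006, §2.7, §4] [cite: Bernardi1981, §1] -/
theorem norm_sigmaHeightTwo_sub_firstOrder_le (V : WeierstrassCurve ℚ) [V.IsIntegral ℤ] {x y : ℚ} (h : V.toAffine.Nonsingular x y)
    (ha1 : V.a₁ = 0) (Sq : ℚ_[2]⟦X⟧) (h0 : constantCoeff Sq = 0) (h1 : coeff 1 Sq = 0) (h2 : coeff 2 Sq = 1) (h3 : coeff 3 Sq = 0)
    (hODE : (V.baseChange ℚ_[2]).SatisfiesSigmaSqODE Sq 0) (hx : (16 : ℝ) ≤ ‖(x : ℚ_[2])‖) :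
    ‖(padicLog 2 (x.den : ℚ_[2]) - padicLog 2 (padicEval Sq (-(x : ℚ_[2]) / y))) -
        (padicLog 2 (x.den : ℚ_[2]) - 2 * padicLog 2 (-(x : ℚ_[2]) / y))‖ ≤ ‖(x : ℚ_[2])‖⁻¹ := by
  obtain ⟨e1, e2, e3, e4, e6⟩ := baseChange_padic_two_a V
  have ha1' : (V.baseChange ℚ_[2]).a₁ = 0 := by rw [e1, ha1, Rat.cast_zero]
  have ha2 : ‖(V.baseChange ℚ_[2]).a₂‖ ≤ 1 := by rw [e2]; exact (mem_localIntegers_iff 2 _).mp (V.a₂_mem_localIntegers 2)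
  have ha3 : ‖(V.baseChange ℚ_[2]).a₃‖ ≤ 1 := by rw [e3]; exact (mem_localIntegers_iff 2 _).mp (V.a₃_mem_localIntegers 2)
  have ha4 : ‖(V.baseChange ℚ_[2]).a₄‖ ≤ 1 := by rw [e4]; exact (mem_localIntegers_iff 2 _).mp (V.a₄_mem_localIntegers 2)
  have ha6 : ‖(V.baseChange ℚ_[2]).a₆‖ ≤ 1 := by rw [e6]; exact (mem_localIntegers_iff 2 _).mp (V.a₆_mem_localIntegers 2)
  obtain ⟨L, hL0, hL⟩ := exists_sigmaLog_two Sq h2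
  have hx1 : 1 < ‖(x : ℚ_[2])‖ := by linarith
  have hsq := WeierstrassCurve.norm_div_sq_eq_inv_norm_of_one_lt_norm h hx1
  have hX0 : (x : ℚ_[2]) ≠ 0 := fun e => by rw [e, norm_zero] at hx1; linarith
  have hY0 : (y : ℚ_[2]) ≠ 0 := by
    intro e
    rw [e, div_zero, norm_zero, zero_pow two_ne_zero] at hsq
    exact (inv_ne_zero (norm_ne_zero_iff.mpr hX0)) hsq.symm
  set t : ℚ_[2] := -(x : ℚ_[2]) / y with htdef
  have ht0 : t ≠ 0 := div_ne_zero (neg_ne_zero.mpr hX0) hY0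
  have htn : ‖t‖ ^ 2 = ‖(x : ℚ_[2])‖⁻¹ := by rw [htdef, neg_div, norm_neg, hsq]
  have ht4 : ‖t‖ ≤ (2⁻¹ : ℝ) ^ 2 := by
    have h16 : ‖t‖ ^ 2 ≤ ((2⁻¹ : ℝ) ^ 2) ^ 2 := by
      rw [htn]
      calc ‖(x : ℚ_[2])‖⁻¹ ≤ (16 : ℝ)⁻¹ := by gcongr
        _ = ((2⁻¹ : ℝ) ^ 2) ^ 2 := by norm_num
    exact (pow_le_pow_iff_left₀ (norm_nonneg _) (by positivity) two_ne_zero).mp h16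
  have key := padicLog_padicEval_sigmaSq_two (V.baseChange ℚ_[2]) Sq L ha1' ha2 ha3 ha4 ha6 h0 h1 h2 h3 hODE hL0 hL t ht0 ht4
  have hbd := norm_padicEval_le_normSq_of_sigmaLog (V.baseChange ℚ_[2]) Sq L t ha1' ha2 ha3 ha4 ha6 h2 h3 hODE hL0 hL
    (ht4.trans (by norm_num))
  rw [key]
  calc ‖padicLog 2 (x.den : ℚ_[2]) - (2 * padicLog 2 t + padicEval L t) - (padicLog 2 (x.den : ℚ_[2]) - 2 * padicLog 2 t)‖
        = ‖padicEval L t‖ := by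
        rw [show padicLog 2 (x.den : ℚ_[2]) - (2 * padicLog 2 t + padicEval L t) - (padicLog 2 (x.den : ℚ_[2]) - 2 * padicLog 2 t)
          = -padicEval L t by ring, norm_neg]
    _ ≤ ‖t‖ ^ 2 := hbd
    _ = ‖(x : ℚ_[2])‖⁻¹ := htn

/-! ### §3 50H — the admissible form at level `≥ 4` -/

/-- **50H — THE ADMISSIBLE FORM** (kernel): at `‖x‖₂ ≥ 256` (level `≥ 4`),
`‖(log₂ den x − log₂ Σ₀(−x/y)) + 2·log₂(num x / num y)‖ ≤ 2⁻⁸` (53E + 53F: `log₂ den x − 2log₂(−x/y) = −2log₂(num x/num y)` because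
`3·log₂ den x = 2·log₂ den y`). [cite: MazurSteinTate2006, §2.7, §4] [cite: Bernardi1981, §1] [cite: SilvermanAEC2009, VII.2.2] -/
theorem norm_sigmaHeightTwo_add_two_mul_padicLog_le (V : WeierstrassCurve ℚ) [V.IsIntegral ℤ] {x y : ℚ}
    (h : V.toAffine.Nonsingular x y) (ha1 : V.a₁ = 0) (Sq : ℚ_[2]⟦X⟧) (h0 : constantCoeff Sq = 0) (h1 : coeff 1 Sq = 0)
    (h2 : coeff 2 Sq = 1) (h3 : coeff 3 Sq = 0) (hODE : (V.baseChange ℚ_[2]).SatisfiesSigmaSqODE Sq 0)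
    (hx : (256 : ℝ) ≤ ‖(x : ℚ_[2])‖) :
    ‖(padicLog 2 (x.den : ℚ_[2]) - padicLog 2 (padicEval Sq (-(x : ℚ_[2]) / y))) +
        2 * padicLog 2 ((x.num : ℚ_[2]) / (y.num : ℚ_[2]))‖ ≤ (2⁻¹ : ℝ) ^ 8 := by
  have hfo := norm_sigmaHeightTwo_sub_firstOrder_le V h ha1 Sq h0 h1 h2 h3 hODE (le_trans (by norm_num) hx)
  have hx1 : 1 < ‖(x : ℚ_[2])‖ := by linarith
  have hsq := WeierstrassCurve.norm_div_sq_eq_inv_norm_of_one_lt_norm h hx1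
  have hX0 : (x : ℚ_[2]) ≠ 0 := fun e => by rw [e, norm_zero] at hx1; linarith
  have hY0 : (y : ℚ_[2]) ≠ 0 := by
    intro e
    rw [e, div_zero, norm_zero, zero_pow two_ne_zero] at hsq
    exact (inv_ne_zero (norm_ne_zero_iff.mpr hX0)) hsq.symm
  have hxq : (x : ℚ_[2]) = (x.num : ℚ_[2]) / (x.den : ℚ_[2]) := by exact_mod_cast (Rat.num_div_den x).symm
  have hyq : (y : ℚ_[2]) = (y.num : ℚ_[2]) / (y.den : ℚ_[2]) := by exact_mod_cast (Rat.num_div_den y).symm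
  have hxd : (x.den : ℚ_[2]) ≠ 0 := by exact_mod_cast x.den_nz
  have hyd : (y.den : ℚ_[2]) ≠ 0 := by exact_mod_cast y.den_nz
  have hxn : (x.num : ℚ_[2]) ≠ 0 := by
    intro e; apply hX0; rw [hxq, e, zero_div]
  have hyn : (y.num : ℚ_[2]) ≠ 0 := by
    intro e; apply hY0; rw [hyq, e, zero_div]
  have hden : 3 * padicLog 2 (x.den : ℚ_[2]) = 2 * padicLog 2 (y.den : ℚ_[2]) := by
    have e := congrArg (fun n : ℕ => padicLog 2 (n : ℚ_[2])) (den_pow_three_eq_den_sq V h)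
    simp only [Nat.cast_pow] at e
    rw [pow_succ, pow_two, pow_two, padicLog_mul_holds 2 (mul_ne_zero hxd hxd) hxd, padicLog_mul_holds 2 hxd hxd,
      padicLog_mul_holds 2 hyd hyd] at e
    linear_combination e
  have hlogt : padicLog 2 (-(x : ℚ_[2]) / y) =
      padicLog 2 (x.num : ℚ_[2]) - padicLog 2 (x.den : ℚ_[2]) - (padicLog 2 (y.num : ℚ_[2]) - padicLog 2 (y.den : ℚ_[2])) := by
    rw [neg_div, padicLog_neg (div_ne_zero hX0 hY0), padicLog_div_two hX0 hY0, hxq, hyq, padicLog_div_two hxn hxd,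
      padicLog_div_two hyn hyd]
  have hlognum : padicLog 2 ((x.num : ℚ_[2]) / (y.num : ℚ_[2])) = padicLog 2 (x.num : ℚ_[2]) - padicLog 2 (y.num : ℚ_[2]) :=
    padicLog_div_two hxn hyn
  have hid : padicLog 2 (x.den : ℚ_[2]) - 2 * padicLog 2 (-(x : ℚ_[2]) / y) =
      -(2 * padicLog 2 ((x.num : ℚ_[2]) / (y.num : ℚ_[2]))) := by
    rw [hlogt, hlognum]; linear_combination hden
  rw [hid, sub_neg_eq_add] at hfo
  refine hfo.trans ?_
  calc ‖(x : ℚ_[2])‖⁻¹ ≤ (256 : ℝ)⁻¹ := by gcongr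
    _ = (2⁻¹ : ℝ) ^ 8 := by norm_num

end NaiveSigmaLogAtTwo

end Summit.BirchSwinnertonDyer.BirchSwinnertonDyer.Theorems
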